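import Mathlib
import HarnessLib
import Literature.NumberTheory.LFunctions.ZetaScrew
import Literature.NumberTheory.LFunctions.UniformWeilPositivityRH
import Literature.NumberTheory.LFunctions.ZetaScrewThm42Proofs
import Summits.RiemannHypothesis.RiemannHypothesis.Theorems.IntegerScrewWeilWindowPSD
import Summits.RiemannHypothesis.RiemannHypothesis.Theorems.ZetaStringKernelWeilDictionary

/-!
# Route `IntegerScrew` — the EXACT integer-level SCREW ↔ WEIL dictionary: balanced windows of the
# screw matrices `S_M` of log-length `2a` ARE Weil positivity at depth `a` (PIVOT-LAW §16; RH-FREE glue)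

PIVOT-LAW §16.2 (p463190, `IntegerScrewWeilWindowPSD`) imported the Weil column's certified rung `a = 1`
into the screw column: `S_M = [G(log m, log m')]`, `G(t,u) = Ψ(t) + Ψ(u) − Ψ(t−u)` (`zetaScrewKernel`,
`Ψ = zetaScrew` Suzuki's screw function of `ζ`), is non-negative on every BALANCED real vector supported
on a window `(N, M]` with `log M − log(N+1) < 2`.  The converse («a failing smooth Weil configuration
of diameter `> 2a₀` is approximated by balanced integer windows») was only ARGUED there.  This file
proves it, for every depth, and in the sharp TAIL form:

* `screwWindow_nonneg_of_weilPositivityOn` — for every real `a`: `WeilPositivityOn a` ⟹ for all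
  `N, M` with `log M − log(N+1) < 2a` and all real `x` with `∑_{N<m≤M} x_m = 0`,
  `0 ≤ ∑_{N<m,m'≤M} G(log m, log m') x_m x_{m'}` (§16.2 at general depth; the dictionary
  `isPosSemidefKernelOn_zetaScrewKernel_iff_weilPositivityOn` + zero-sum recentring);
* `weilPositivityOn_of_eventually_screwWindow_nonneg` — conversely, if the balanced-window
  inequality holds for all windows of log-length `< 2a` ABOVE SOME `N₀` (`N ≥ N₀`), then
  `WeilPositivityOn a`.  DENSITY TRANSFER: a zero-sum real configuration `(sₖ, yₖ)` of diameter
  `D < 2a` is realised, for each `N`, on the nodes `mₖ(N) = ⌈(N+1)·e^{sₖ − min s}⌉ ∈ (N, ⌈(N+1)e^D⌉]`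
  (weights aggregated fibrewise, so the vector stays EXACTLY balanced); `log mₖ(N) − log(N+1) →
  sₖ − min s`, `Ψ` is continuous (`continuous_zetaScrew`), and the balanced form only sees differences;
* `weilPositivityOn_iff_forall_screwWindow_nonneg`, `weilPositivityOn_iff_eventually_screwWindow_nonneg`
  — the two EXACT DICTIONARIES (all windows / the tail of the matrix family: only the top windows of
  large matrices matter), and `screwWindow_nonneg_of_eventually` (positivity propagates down from the
  tail).  The ratio form `M ≤ R(N+1)` and the RH-EQUIVALENT `∀ R` reading are in the sequel
  `IntegerScrewWeilWindowRatio`.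

LABEL: RH-FREE glue (density + continuity + the tree's dictionary); no positivity of `ζ`'s Weil form is
asserted beyond what a hypothesis supplies; for ALL depths `a` either side is Weil's criterion
(`riemannHypothesis_iff_forall_weilPositivityOn`, RH-EQUIVALENT, labelled, not claimed).  WHAT THIS IS
NOT: not progress toward RH; it types WHERE RH sits in the integer screw matrices (balanced windows of
unbounded log-length) and that each window length is one Weil depth.  Nothing here bears on the truth
of RH.

References: M. Suzuki, J. Lond. Math. Soc. (2) 108 (2023) 1448–1487 = arXiv:2206.03682, (1.1),
(1.4)–(1.5), Thm 1.2, Prop. 3.1 [Suzuki2023]; A. Weil (1952); H. Yoshida, Adv. Stud. Pure Math. 21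
(1992); E. Bombieri, Rend. Lincei (9) 11 (2000) Thm. 2.
-/

noncomputable section

-- D-0017: `Summit.<S>.<S>.…` is the designed namespace of a single-problem summit.
set_option linter.dupNamespace false

namespace Summit.RiemannHypothesis.RiemannHypothesis.Theorems.IntegerScrew

open Literature.NumberTheory.LFunctions Finset Filter Topology
open Summit.RiemannHypothesis.RiemannHypothesis.Theorems.KernelOfWeilOn
  (sum_sum_mul_zetaScrew_nonpos_of_psd)
open Summit.RiemannHypothesis.RiemannHypothesis.Theorems.ZetaStringArchWall
  (isPosSemidefKernelOn_zetaScrewKernel_iff_weilPositivityOn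
    weilPositivityOn_iff_sum_sum_zetaScrewKernel_nonneg)

/-! ## §1 Bookkeeping: balanced forms see only differences; fibrewise aggregation onto nodes -/

/-- For zero-sum weights the screw form is translation invariant in the configuration:
`∑ᵢⱼ G(tᵢ + c, tⱼ + c) yᵢ yⱼ = ∑ᵢⱼ G(tᵢ, tⱼ) yᵢ yⱼ` (both equal `−∑ yᵢyⱼ Ψ(tᵢ − tⱼ)`). [folklore] -/
theorem screwForm_add_const_of_sum_eq_zero {n : ℕ} (t y : Fin n → ℝ) (c : ℝ)
    (hy : ∑ i, y i = 0) :
    ∑ i, ∑ j, zetaScrewKernel (t i + c) (t j + c) * (y i * y j) =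
      ∑ i, ∑ j, zetaScrewKernel (t i) (t j) * (y i * y j) := by
  rw [sum_sum_zetaScrewKernel_eq_neg_of_sum_eq_zero _ y hy,
    sum_sum_zetaScrewKernel_eq_neg_of_sum_eq_zero t y hy]
  simp only [add_sub_add_right_eq_sub]

/-- The screw form `∑ᵢⱼ G(uᵢ, uⱼ) yᵢ yⱼ` is continuous in the configuration along any filter:
if `u_N(k) → s(k)` for every `k` then the forms converge (`Ψ` is continuous, `continuous_zetaScrew`).
[folklore] -/
theorem tendsto_screwForm {ι : Type*} {l : Filter ι} {n : ℕ} {u : ι → Fin n → ℝ} {s : Fin n → ℝ}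
    (hu : ∀ k, Tendsto (fun N => u N k) l (𝓝 (s k))) (y : Fin n → ℝ) :
    Tendsto (fun N => ∑ i, ∑ j, zetaScrewKernel (u N i) (u N j) * (y i * y j)) l
      (𝓝 (∑ i, ∑ j, zetaScrewKernel (s i) (s j) * (y i * y j))) := by
  refine tendsto_finsetSum _ fun i _ => tendsto_finsetSum _ fun j _ => ?_
  refine Tendsto.mul ?_ tendsto_const_nhds
  simp only [zetaScrewKernel_def]
  exact (((continuous_zetaScrew.tendsto _).comp (hu i)).add
    ((continuous_zetaScrew.tendsto _).comp (hu j))).sub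
      ((continuous_zetaScrew.tendsto _).comp ((hu i).sub (hu j)))

/-- FIBREWISE AGGREGATION: if the balanced-window inequality holds on `(N, M]`, it holds for every
`Fin`-indexed family of nodes `mᵢ ∈ (N, M]` (repetitions allowed) with zero-sum weights — aggregate
the weights of equal nodes into one vector `x_m = ∑_{i : mᵢ = m} yᵢ`, which is still balanced and has
the same form. [folklore] -/
theorem screwForm_nodes_nonneg_of_window {N M : ℕ}
    (hW : ∀ x : ℕ → ℝ, ∑ m ∈ Ioc N M, x m = 0 →
      0 ≤ ∑ m ∈ Ioc N M, ∑ m' ∈ Ioc N M,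
        zetaScrewKernel (Real.log m) (Real.log m') * (x m * x m'))
    {n : ℕ} (nd : Fin n → ℕ) (hnd : ∀ i, N < nd i ∧ nd i ≤ M) (y : Fin n → ℝ)
    (hy : ∑ i, y i = 0) :
    0 ≤ ∑ i, ∑ j, zetaScrewKernel (Real.log (nd i)) (Real.log (nd j)) * (y i * y j) := by
  classical
  set S : Finset ℕ := Ioc N M with hS
  set x : ℕ → ℝ := fun m => ∑ i ∈ Finset.univ.filter (fun i => nd i = m), y i with hx
  have hmaps : ∀ i ∈ (Finset.univ : Finset (Fin n)), nd i ∈ S :=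
    fun i _ => Finset.mem_Ioc.2 (hnd i)
  have hxsum : ∑ m ∈ S, x m = 0 := by
    simp only [hx]
    rw [Finset.sum_fiberwise_of_maps_to hmaps, hy]
  have key := hW x hxsum
  -- the aggregated form equals the `Fin`-indexed form
  set F : Fin n → Fin n → ℝ := fun i j =>
    zetaScrewKernel (Real.log (nd i)) (Real.log (nd j)) * (y i * y j) with hF
  have hinner : ∀ m ∈ S, ∀ m' ∈ S,
      zetaScrewKernel (Real.log m) (Real.log m') * (x m * x m') =
        ∑ i ∈ Finset.univ.filter (fun i => nd i = m),
          ∑ j ∈ Finset.univ.filter (fun j => nd j = m'), F i j := by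
    intro m _ m' _
    simp only [hx]
    rw [Finset.sum_mul_sum, Finset.mul_sum]
    refine Finset.sum_congr rfl fun i hi => ?_
    rw [Finset.mul_sum]
    refine Finset.sum_congr rfl fun j hj => ?_
    have hi' : nd i = m := (Finset.mem_filter.1 hi).2
    have hj' : nd j = m' := (Finset.mem_filter.1 hj).2
    simp only [hF, hi', hj']
  have hform : ∑ m ∈ S, ∑ m' ∈ S, zetaScrewKernel (Real.log m) (Real.log m') * (x m * x m') =
      ∑ i, ∑ j, F i j := by
    calc ∑ m ∈ S, ∑ m' ∈ S, zetaScrewKernel (Real.log m) (Real.log m') * (x m * x m')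
        = ∑ m ∈ S, ∑ m' ∈ S, ∑ i ∈ Finset.univ.filter (fun i => nd i = m),
            ∑ j ∈ Finset.univ.filter (fun j => nd j = m'), F i j :=
          Finset.sum_congr rfl fun m hm => Finset.sum_congr rfl fun m' hm' => hinner m hm m' hm'
      _ = ∑ m ∈ S, ∑ i ∈ Finset.univ.filter (fun i => nd i = m),
            ∑ m' ∈ S, ∑ j ∈ Finset.univ.filter (fun j => nd j = m'), F i j :=
          Finset.sum_congr rfl fun m _ => Finset.sum_comm
      _ = ∑ i, ∑ m' ∈ S, ∑ j ∈ Finset.univ.filter (fun j => nd j = m'), F i j :=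
          Finset.sum_fiberwise_of_maps_to hmaps _
      _ = ∑ i, ∑ j, F i j :=
          Finset.sum_congr rfl fun i _ => Finset.sum_fiberwise_of_maps_to hmaps _
  rw [hform] at key
  simpa [hF] using key

/-- Conversely the `Fin`-indexed inequality for node families in `(N, M]` gives the window inequality
for vectors `x : ℕ → ℝ` (re-index `Ioc N M` by `Fin`). [folklore] -/
theorem screwWindow_nonneg_of_nodes {N M : ℕ}
    (h : ∀ (n : ℕ) (nd : Fin n → ℕ), (∀ i, N < nd i ∧ nd i ≤ M) → ∀ y : Fin n → ℝ,
      ∑ i, y i = 0 → 0 ≤ ∑ i, ∑ j, zetaScrewKernel (Real.log (nd i)) (Real.log (nd j)) * (y i * y j))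
    (x : ℕ → ℝ) (hx : ∑ m ∈ Ioc N M, x m = 0) :
    0 ≤ ∑ m ∈ Ioc N M, ∑ m' ∈ Ioc N M,
      zetaScrewKernel (Real.log m) (Real.log m') * (x m * x m') := by
  set s : Finset ℕ := Ioc N M with hs
  set e := s.equivFin with he
  have hmem : ∀ i : Fin s.card, N < (e.symm i : ℕ) ∧ (e.symm i : ℕ) ≤ M := by
    intro i
    have h : ((e.symm i : ℕ)) ∈ Ioc N M := (e.symm i).2
    exact Finset.mem_Ioc.1 h
  have hsum1 : ∀ f : ℕ → ℝ, ∑ m ∈ s, f m = ∑ i : Fin s.card, f (e.symm i) := by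
    intro f
    rw [← Finset.sum_coe_sort s f]
    exact (Fintype.sum_equiv e.symm (fun i => f (e.symm i)) (fun m => f m) fun i => rfl).symm
  have hx' : ∑ i : Fin s.card, x (e.symm i) = 0 := by rw [← hsum1]; exact hx
  have key := h s.card (fun i => (e.symm i : ℕ)) hmem (fun i => x (e.symm i)) hx'
  rw [hsum1]
  simp_rw [hsum1]
  exact key

/-! ## §2 WEIL ⟹ SCREW WINDOWS at every depth (§16.2 for general `a`) -/

/-- **`S_M ⪰ 0` on balanced vectors of every window of log-length `< 2a`, from `WeilPositivityOn a`**
(`Fin`-indexed node families): if `log M − log(N+1) < 2a`, `mᵢ ∈ (N, M]`, `∑ yᵢ = 0`, then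
`0 ≤ ∑ᵢⱼ G(log mᵢ, log mⱼ) yᵢ yⱼ`.  (Dictionary `G ≽ 0 on (−a,a) ↔ WeilPositivityOn a`, then the
zero-sum recentring `sum_sum_mul_zetaScrew_nonpos_of_psd`.) [cite: Suzuki2023, (1.4)–(1.5) and Prop 3.1] -/
theorem screwForm_balanced_nonneg_of_weilPositivityOn {a : ℝ} (hW : WeilPositivityOn a) {N M : ℕ}
    (hNM : Real.log M - Real.log ((N : ℝ) + 1) < 2 * a) {n : ℕ} (nd : Fin n → ℕ)
    (hnd : ∀ i, N < nd i ∧ nd i ≤ M) (y : Fin n → ℝ) (hy : ∑ i, y i = 0) :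
    0 ≤ ∑ i, ∑ j, zetaScrewKernel (Real.log (nd i)) (Real.log (nd j)) * (y i * y j) := by
  have hN1 : (0 : ℝ) < (N : ℝ) + 1 := by positivity
  have hdiam : ∀ i j, Real.log (nd i) - Real.log (nd j) < 2 * a := by
    intro i j
    have hi2 : (nd i : ℝ) ≤ M := by exact_mod_cast (hnd i).2
    have hj1 : (N : ℝ) + 1 ≤ nd j := by exact_mod_cast Nat.succ_le_of_lt (hnd j).1
    have hipos : (0 : ℝ) < nd i := hN1.trans_le (by exact_mod_cast Nat.succ_le_of_lt (hnd i).1)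
    have hli : Real.log (nd i) ≤ Real.log M := Real.log_le_log hipos hi2
    have hlj : Real.log ((N : ℝ) + 1) ≤ Real.log (nd j) := Real.log_le_log hN1 hj1
    linarith
  have hpsd := (isPosSemidefKernelOn_zetaScrewKernel_iff_weilPositivityOn a).2 hW
  have h := sum_sum_mul_zetaScrew_nonpos_of_psd hpsd (fun i => Real.log (nd i)) y hdiam hy
  rw [sum_sum_zetaScrewKernel_eq_neg_of_sum_eq_zero _ y hy]
  linarith

/-- **WEIL ⟹ SCREW WINDOWS** (PIVOT-LAW §16.2 at every depth; RH-FREE glue): `WeilPositivityOn a`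
implies, for all `N, M` with `log M − log(N+1) < 2a` and all real `x` with `∑_{N<m≤M} x_m = 0`,
`0 ≤ ∑_{N<m,m'≤M} G(log m, log m') x_m x_{m'}` — `S_M` is non-negative on every balanced vector
supported on `(N, M]`. [cite: Suzuki2023, (1.4)–(1.5) and Prop 3.1] -/
theorem screwWindow_nonneg_of_weilPositivityOn {a : ℝ} (hW : WeilPositivityOn a) (N M : ℕ)
    (hNM : Real.log M - Real.log ((N : ℝ) + 1) < 2 * a) (x : ℕ → ℝ)
    (hx : ∑ m ∈ Ioc N M, x m = 0) :
    0 ≤ ∑ m ∈ Ioc N M, ∑ m' ∈ Ioc N M,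
      zetaScrewKernel (Real.log m) (Real.log m') * (x m * x m') :=
  screwWindow_nonneg_of_nodes
    (fun _ nd hnd y hy => screwForm_balanced_nonneg_of_weilPositivityOn hW hNM nd hnd y hy) x hx

/-! ## §3 The nodes `⌈(N+1)e^σ⌉`: position `σ` above `log(N+1)` in the limit -/

/-- `log ⌈(N+1)e^σ⌉ − log(N+1) → σ` as `N → ∞` (`⌈y⌉/y → 1` for `y = (N+1)e^σ → ∞`). [folklore] -/
theorem tendsto_log_ceil_sub_log (σ : ℝ) :
    Tendsto (fun N : ℕ => Real.log (⌈((N : ℝ) + 1) * Real.exp σ⌉₊ : ℕ) - Real.log ((N : ℝ) + 1))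
      atTop (𝓝 σ) := by
  have hN1 : ∀ N : ℕ, (0 : ℝ) < (N : ℝ) + 1 := fun N => by positivity
  have hy : ∀ N : ℕ, (0 : ℝ) < ((N : ℝ) + 1) * Real.exp σ := fun N => by positivity
  -- the ratio `r N = ⌈y⌉ / (N+1)` is squeezed between `e^σ` and `e^σ + 1/(N+1)`
  set r : ℕ → ℝ := fun N => (⌈((N : ℝ) + 1) * Real.exp σ⌉₊ : ℕ) / ((N : ℝ) + 1) with hr
  have hlow : ∀ N, Real.exp σ ≤ r N := by
    intro N
    rw [hr]
    simp only
    rw [le_div_iff₀ (hN1 N), mul_comm]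
    exact Nat.le_ceil _
  have hup : ∀ N, r N ≤ Real.exp σ + 1 / ((N : ℝ) + 1) := by
    intro N
    have hc : ((⌈((N : ℝ) + 1) * Real.exp σ⌉₊ : ℕ) : ℝ) < ((N : ℝ) + 1) * Real.exp σ + 1 :=
      Nat.ceil_lt_add_one (hy N).le
    have e : (Real.exp σ + 1 / ((N : ℝ) + 1)) * ((N : ℝ) + 1) = ((N : ℝ) + 1) * Real.exp σ + 1 := by
      field_simp
    rw [hr]
    simp only
    rw [div_le_iff₀ (hN1 N), e]
    exact hc.le
  have hlim1 : Tendsto (fun N : ℕ => Real.exp σ + 1 / ((N : ℝ) + 1)) atTop (𝓝 (Real.exp σ)) := by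
    have h : Tendsto (fun N : ℕ => 1 / ((N : ℝ) + 1)) atTop (𝓝 0) :=
      tendsto_one_div_add_atTop_nhds_zero_nat
    simpa using h.const_add (Real.exp σ)
  have hr_lim : Tendsto r atTop (𝓝 (Real.exp σ)) :=
    tendsto_of_tendsto_of_tendsto_of_le_of_le tendsto_const_nhds hlim1 hlow hup
  have hlog : Tendsto (fun N => Real.log (r N)) atTop (𝓝 (Real.log (Real.exp σ))) :=
    ((Real.continuousAt_log (Real.exp_pos σ).ne').tendsto).comp hr_lim
  rw [Real.log_exp] at hlog
  refine hlog.congr fun N => ?_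
  have hceil : (0 : ℝ) < (⌈((N : ℝ) + 1) * Real.exp σ⌉₊ : ℕ) := (hy N).trans_le (Nat.le_ceil _)
  rw [hr]
  simp only
  rw [Real.log_div hceil.ne' (hN1 N).ne']

/-- The node `⌈(N+1)e^σ⌉` lies above `N` when `σ ≥ 0`. [folklore] -/
theorem lt_ceil_node {N : ℕ} {σ : ℝ} (hσ : 0 ≤ σ) : N < ⌈((N : ℝ) + 1) * Real.exp σ⌉₊ := by
  rw [Nat.lt_ceil]
  have h1 : (1 : ℝ) ≤ Real.exp σ := Real.one_le_exp hσ
  have hN : (0 : ℝ) ≤ N := Nat.cast_nonneg N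
  nlinarith

/-- The nodes are monotone in the position: `σ ≤ τ ⟹ ⌈(N+1)e^σ⌉ ≤ ⌈(N+1)e^τ⌉`. [folklore] -/
theorem ceil_node_mono (N : ℕ) {σ τ : ℝ} (h : σ ≤ τ) :
    ⌈((N : ℝ) + 1) * Real.exp σ⌉₊ ≤ ⌈((N : ℝ) + 1) * Real.exp τ⌉₊ :=
  Nat.ceil_mono (mul_le_mul_of_nonneg_left (Real.exp_le_exp.2 h) (by positivity))

/-! ## §4 DENSITY TRANSFER: screw windows in the tail ⟹ real configurations ⟹ Weil -/

/-- **DENSITY TRANSFER.** If the balanced-window inequality holds for all windows `(N, M]` of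
log-length `< 2a` with `N ≥ N₀`, then `0 ≤ ∑ᵢⱼ G(sᵢ, sⱼ) yᵢ yⱼ` for every zero-sum real system
`(sᵢ, yᵢ)` of diameter `< 2a`.  (Realise `sᵢ` on the nodes `⌈(N+1)e^{sᵢ − min s}⌉ ∈ (N, ⌈(N+1)e^D⌉]`,
`D` the diameter; the window has log-length `→ D < 2a`; the balanced form of the node configuration
recentred by `log(N+1)` tends to the form of `(sᵢ − min s)`, which is the form of `(sᵢ)`; limits of
non-negative reals are non-negative.) [folklore] -/
theorem screwForm_balanced_nonneg_of_eventually_window {a : ℝ}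
    (h : ∃ N₀ : ℕ, ∀ N M : ℕ, N₀ ≤ N → Real.log M - Real.log ((N : ℝ) + 1) < 2 * a →
      ∀ x : ℕ → ℝ, ∑ m ∈ Ioc N M, x m = 0 →
        0 ≤ ∑ m ∈ Ioc N M, ∑ m' ∈ Ioc N M,
          zetaScrewKernel (Real.log m) (Real.log m') * (x m * x m'))
    {n : ℕ} (s y : Fin n → ℝ) (hs : ∀ i j, s i - s j < 2 * a) (hy : ∑ i, y i = 0) :
    0 ≤ ∑ i, ∑ j, zetaScrewKernel (s i) (s j) * (y i * y j) := by
  rcases Nat.eq_zero_or_pos n with hn | hn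
  · subst hn; simp
  obtain ⟨N₀, hN₀⟩ := h
  haveI : Nonempty (Fin n) := Fin.pos_iff_nonempty.1 hn
  have hne : (Finset.univ : Finset (Fin n)).Nonempty := Finset.univ_nonempty
  obtain ⟨imin, -, himin⟩ := Finset.exists_min_image Finset.univ s hne
  obtain ⟨imax, -, himax⟩ := Finset.exists_max_image Finset.univ s hne
  set smin : ℝ := s imin with hsmin_def
  set D : ℝ := s imax - smin with hD_def
  have hsmin : ∀ k, smin ≤ s k := fun k => himin k (Finset.mem_univ k)
  have hD : ∀ k, s k - smin ≤ D := fun k => by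
    have := himax k (Finset.mem_univ k); rw [hD_def]; linarith
  have hD2a : D < 2 * a := hs imax imin
  -- nodes and window tops
  set nd : ℕ → Fin n → ℕ := fun N k => ⌈((N : ℝ) + 1) * Real.exp (s k - smin)⌉₊ with hnd_def
  set Mx : ℕ → ℕ := fun N => ⌈((N : ℝ) + 1) * Real.exp D⌉₊ with hMx_def
  have hnd : ∀ N k, N < nd N k ∧ nd N k ≤ Mx N := fun N k =>
    ⟨lt_ceil_node (sub_nonneg.2 (hsmin k)), ceil_node_mono N (hD k)⟩
  -- the recentred node configurations converge to `s − smin`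
  set u : ℕ → Fin n → ℝ := fun N k => Real.log (nd N k) - Real.log ((N : ℝ) + 1) with hu_def
  have hu : ∀ k, Tendsto (fun N => u N k) atTop (𝓝 (s k - smin)) := fun k =>
    tendsto_log_ceil_sub_log (s k - smin)
  have hform : Tendsto (fun N => ∑ i, ∑ j, zetaScrewKernel (u N i) (u N j) * (y i * y j)) atTop
      (𝓝 (∑ i, ∑ j, zetaScrewKernel (s i - smin) (s j - smin) * (y i * y j))) :=
    tendsto_screwForm (s := fun k => s k - smin) hu y
  -- eventually the window `(N, Mx N]` is short enough and `N ≥ N₀`, so the node form is `≥ 0`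
  have hev : ∀ᶠ N in atTop, 0 ≤ ∑ i, ∑ j, zetaScrewKernel (u N i) (u N j) * (y i * y j) := by
    have h1 : ∀ᶠ N : ℕ in atTop,
        Real.log (Mx N) - Real.log ((N : ℝ) + 1) < 2 * a :=
      (tendsto_log_ceil_sub_log D).eventually (eventually_lt_nhds hD2a)
    have h2 : ∀ᶠ N : ℕ in atTop, N₀ ≤ N := eventually_ge_atTop N₀
    filter_upwards [h1, h2] with N h1 h2
    have key := screwForm_nodes_nonneg_of_window (hN₀ N (Mx N) h2 h1) (nd N) (hnd N) y hy
    -- recentring by `−log(N+1)` does not change the balanced form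
    have e : ∀ k, u N k = Real.log (nd N k) + (-Real.log ((N : ℝ) + 1)) := fun k => by
      simp only [hu_def, sub_eq_add_neg]
    simp only [e]
    rw [screwForm_add_const_of_sum_eq_zero (fun k => Real.log (nd N k)) y _ hy]
    exact key
  have hlim := ge_of_tendsto hform hev
  -- the limit configuration `s − smin` has the same balanced form as `s`
  have e2 : ∀ k, s k - smin = s k + (-smin) := fun k => sub_eq_add_neg _ _
  simp only [e2] at hlim
  rw [screwForm_add_const_of_sum_eq_zero s y _ hy] at hlim
  exact hlim

/-- **SCREW WINDOWS IN THE TAIL ⟹ WEIL** (the converse of §16.2, RH-FREE): if for some `N₀` the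
balanced-window inequality `0 ≤ ∑_{N<m,m'≤M} G(log m, log m') x_m x_{m'}` (`∑ x_m = 0`) holds for all
`N ≥ N₀` and all `M` with `log M − log(N+1) < 2a`, then `WeilPositivityOn a`.  (For `a ≤ 0` Weil
positivity is Yoshida's theorem; for `a > 0` augment a configuration in `(−a, a)` by the node `0` with
the balancing weight — `Suzuki2023Thm42.sum_sum_zetaScrewKernel_eq_neg` — and apply the density transfer and the dictionary
`weilPositivityOn_iff_sum_sum_zetaScrewKernel_nonneg`.) [cite: Suzuki2023, (1.4)–(1.5) and Prop 3.1] -/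
theorem weilPositivityOn_of_eventually_screwWindow_nonneg {a : ℝ}
    (h : ∃ N₀ : ℕ, ∀ N M : ℕ, N₀ ≤ N → Real.log M - Real.log ((N : ℝ) + 1) < 2 * a →
      ∀ x : ℕ → ℝ, ∑ m ∈ Ioc N M, x m = 0 →
        0 ≤ ∑ m ∈ Ioc N M, ∑ m' ∈ Ioc N M,
          zetaScrewKernel (Real.log m) (Real.log m') * (x m * x m')) :
    WeilPositivityOn a := by
  by_cases ha : 0 < a
  swap
  · exact weilPositivityOn_of_le_log_two_half
      ((not_lt.1 ha).trans (div_nonneg (Real.log_nonneg one_le_two) zero_le_two))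
  rw [weilPositivityOn_iff_sum_sum_zetaScrewKernel_nonneg]
  intro n t c ht
  -- augment by the node `0` with the balancing weight `−∑ c`
  have hy : ∑ i, (Fin.cons (-∑ i, c i) c : Fin (n + 1) → ℝ) i = 0 := by
    rw [Fin.sum_univ_succ]
    simp only [Fin.cons_zero, Fin.cons_succ]
    ring
  have hs : ∀ i j, (Fin.cons 0 t : Fin (n + 1) → ℝ) i - (Fin.cons 0 t : Fin (n + 1) → ℝ) j
      < 2 * a := by
    have hpt : ∀ i, |(Fin.cons 0 t : Fin (n + 1) → ℝ) i| < a := by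
      intro i
      refine Fin.cases ?_ (fun k => ?_) i
      · simp [ha]
      · simpa using ht k
    intro i j
    have hi := abs_lt.1 (hpt i)
    have hj := abs_lt.1 (hpt j)
    linarith [hi.2, hj.1]
  have key := screwForm_balanced_nonneg_of_eventually_window h _ _ hs hy
  rw [sum_sum_zetaScrewKernel_eq_neg_of_sum_eq_zero _ _ hy] at key
  rw [Suzuki2023Thm42.sum_sum_zetaScrewKernel_eq_neg t c]
  exact key

/-! ## §5 The exact dictionaries at depth `a` -/

/-- **EXACT DICTIONARY (all windows).** For every real `a`:
`WeilPositivityOn a ↔ ∀ N M, log M − log(N+1) < 2a → ∀ x, ∑_{N<m≤M} x_m = 0 →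
0 ≤ ∑_{N<m,m'≤M} G(log m, log m') x_m x_{m'}` — Weil positivity at depth `a` IS non-negativity of
Suzuki's screw matrices on the balanced vectors of all integer windows of log-length `< 2a`.
[cite: Suzuki2023, (1.4)–(1.5), Thm 1.2 and Prop 3.1] -/
theorem weilPositivityOn_iff_forall_screwWindow_nonneg (a : ℝ) :
    WeilPositivityOn a ↔ ∀ N M : ℕ, Real.log M - Real.log ((N : ℝ) + 1) < 2 * a →
      ∀ x : ℕ → ℝ, ∑ m ∈ Ioc N M, x m = 0 →
        0 ≤ ∑ m ∈ Ioc N M, ∑ m' ∈ Ioc N M,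
          zetaScrewKernel (Real.log m) (Real.log m') * (x m * x m') :=
  ⟨fun hW N M hNM x hx => screwWindow_nonneg_of_weilPositivityOn hW N M hNM x hx,
    fun h => weilPositivityOn_of_eventually_screwWindow_nonneg ⟨0, fun N M _ hNM => h N M hNM⟩⟩

/-- **EXACT DICTIONARY (tail form).** For every real `a`: `WeilPositivityOn a` iff there is `N₀` such
that the balanced-window inequality holds for all windows `(N, M]` of log-length `< 2a` with `N ≥ N₀`
— only the TOP windows of LARGE screw matrices matter, and they already force every window.
[cite: Suzuki2023, (1.4)–(1.5), Thm 1.2 and Prop 3.1] -/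
theorem weilPositivityOn_iff_eventually_screwWindow_nonneg (a : ℝ) :
    WeilPositivityOn a ↔ ∃ N₀ : ℕ, ∀ N M : ℕ, N₀ ≤ N → Real.log M - Real.log ((N : ℝ) + 1) < 2 * a →
      ∀ x : ℕ → ℝ, ∑ m ∈ Ioc N M, x m = 0 →
        0 ≤ ∑ m ∈ Ioc N M, ∑ m' ∈ Ioc N M,
          zetaScrewKernel (Real.log m) (Real.log m') * (x m * x m') :=
  ⟨fun hW => ⟨0, fun N M _ hNM x hx => screwWindow_nonneg_of_weilPositivityOn hW N M hNM x hx⟩,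
    weilPositivityOn_of_eventually_screwWindow_nonneg⟩

/-- **PROPAGATION FROM THE TAIL** (RH-FREE): if the balanced-window inequality holds on all windows of
log-length `< 2a` above some `N₀`, it holds on ALL windows of log-length `< 2a` (through
`WeilPositivityOn a`). [folklore] -/
theorem screwWindow_nonneg_of_eventually {a : ℝ}
    (h : ∃ N₀ : ℕ, ∀ N M : ℕ, N₀ ≤ N → Real.log M - Real.log ((N : ℝ) + 1) < 2 * a →
      ∀ x : ℕ → ℝ, ∑ m ∈ Ioc N M, x m = 0 →
        0 ≤ ∑ m ∈ Ioc N M, ∑ m' ∈ Ioc N M,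
          zetaScrewKernel (Real.log m) (Real.log m') * (x m * x m'))
    (N M : ℕ) (hNM : Real.log M - Real.log ((N : ℝ) + 1) < 2 * a) (x : ℕ → ℝ)
    (hx : ∑ m ∈ Ioc N M, x m = 0) :
    0 ≤ ∑ m ∈ Ioc N M, ∑ m' ∈ Ioc N M,
      zetaScrewKernel (Real.log m) (Real.log m') * (x m * x m') :=
  screwWindow_nonneg_of_weilPositivityOn (weilPositivityOn_of_eventually_screwWindow_nonneg h)
    N M hNM x hx

end Summit.RiemannHypothesis.RiemannHypothesis.Theorems.IntegerScrew

end
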